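import Summits.KontsevichZagierPeriods.KontsevichZagierPeriods.Theorems.SoloBlindSilver
import HarnessLib

/-!
# The arc length of the parabola inside the rules

The region under `y = ½√(1+x²)` over `(0,1)`,

  `P = {(x,y) | 0 < x < 1, 0 ≤ y, 4y² ≤ 1 + x²}`,  `area(P) = ½ ∫₀¹ √(1+x²) dx`

(half the arc length of `y = x²/2`, `0 ≤ x ≤ 1`), is `ℚ`-rational, and its period is the
INHOMOGENEOUS linear form `area(P) = (√2 + log (1+√2))/4` in `1` and the regulator of `ℚ(√2)`.
By KZ moves only: ONE Newton–Leibniz move to the line and the silver chart `x = (u²-1)/(2u)`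
of `SoloBlindSilver` carry `P` to the `ℚ`-RATIONAL one-variable representation
`ρ = [(1, 1+√2), (u²+1)² du/(8u³)]` (`rho_sub_parab1`), so `[P] ∈ V` (`mkQ_parab2_mem_cellSpan`)
and the Kontsevich–Zagier conjecture holds for `P` against every class in the cell span
(`kz_parab2`).  Evaluating `ρ` by the fundamental theorem of calculus (`rho_value`) and using
Baker injectivity on `V` once: **`4[P] = κ(√2) + ℓ(1+√2)`** (`four_mkQ_parab2`), i.e. four
copies of `P` are KZ-equivalent to the point cell `√2` plus the logarithmic cell `L(1; 1+√2)`
(`four_parab2_sub_mem_relations`); `P` and the silver region `Σ` are tied by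
`4[P] - [Σ] = κ(√2)` (`four_mkQ_parab2_sub_mkQ_hyp2`).

References: Kontsevich–Zagier, *Periods* (2001), §1.1–1.2; Baker (1975), Ch. 2.
-/

noncomputable section

namespace Summit.KontsevichZagierPeriods.KontsevichZagierPeriods.Theorems

open Set MeasureTheory
open Literature.ModelTheory.ExponentialFields (IsSemialgebraic)
open MvPolynomial (aeval X C)
open Literature.NumberTheory.Transcendental
open Literature.NumberTheory.Transcendental.KZ

namespace SoloBlind

/-! ## The integrand `p(x) = ½√(1+x²)` and `P₁ = [(0,1), p]` -/

/-- `p(x) = ½ (1 + x²)^{1/2}`. -/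
def parabF (x : ℝ) : ℝ := ((((1:ℚ) / 2 : ℚ)) : ℝ) * (1 + x ^ 2) ^ ((((1:ℚ) / 2 : ℚ) : ℝ))

/-- `p(x) = √(1+x²)/2`. -/
theorem parabF_eq (x : ℝ) : parabF x = Real.sqrt (1 + x ^ 2) / 2 := by
  rw [parabF, Real.sqrt_eq_rpow]
  push_cast
  ring

/-- `0 ≤ p(x)`. -/
theorem parabF_nonneg (x : ℝ) : 0 ≤ parabF x := by
  rw [parabF_eq]
  positivity

/-- `p` is continuous. -/
theorem continuous_parabF : Continuous parabF :=
  continuous_const.mul ((continuous_const.add (continuous_pow 2)).rpow_const fun x =>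
    Or.inl (by positivity : (0:ℝ) < 1 + x ^ 2).ne')

/-- `p` is integrable on `(0,1)`. -/
theorem integrableOn_parabF : IntegrableOn parabF (Ioo 0 1) :=
  (continuous_parabF.continuousOn.integrableOn_Icc (μ := volume)).mono_set Ioo_subset_Icc_self

/-- `p` is `ℚ`-semialgebraic on `(0,1)` (an Euler–Mellin integrand). -/
theorem isSemialgebraicFunOn_parabF :
    IsSemialgebraicFunOn ℚ (line (Ioo 0 1)) (fun x : Fin 1 → ℝ => parabF (x 0)) := by
  have h := isSemialgebraicFunOn_mellinIntegrand
    (isSemialgebraic_line_Ioo isAlgebraic_zero isAlgebraic_one)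
    ![(1 + X 0 ^ 2 : MvPolynomial (Fin 1) ℚ)] ![((1:ℚ) / 2 : ℚ)] ((1:ℚ) / 2) (fun x _ k => by
      have hx : (0:ℝ) < 1 + x 0 ^ 2 := by positivity
      simpa using hx)
  refine h.congr fun x _ => ?_
  simp only [mellinIntegrand_apply, Fin.prod_univ_one, Matrix.cons_val_fin_one, map_add, map_one,
    map_pow, MvPolynomial.aeval_X, parabF]

/-- **`P₁ = [(0,1), ½(1+x²)^{1/2}]`.** -/
def parab1 : IntegralRep 1 :=
  lineRep (Ioo 0 1) parabF (isSemialgebraic_line_Ioo isAlgebraic_zero isAlgebraic_one)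
    isSemialgebraicFunOn_parabF integrableOn_parabF

/-! ## The region `P` -/

/-- `P = {0 < x < 1, 0 ≤ y, 4y² ≤ 1 + x²}`. -/
def kzParab : Set (Fin 2 → ℝ) :=
  {z | (0 < z 0 ∧ z 0 < 1) ∧ 0 ≤ z 1 ∧ 4 * z 1 ^ 2 ≤ 1 + z 0 ^ 2}

/-- Membership in `kzParab`, unfolded. -/
theorem mem_kzParab {z : Fin 2 → ℝ} :
    z ∈ kzParab ↔ (0 < z 0 ∧ z 0 < 1) ∧ 0 ≤ z 1 ∧ 4 * z 1 ^ 2 ≤ 1 + z 0 ^ 2 := Iff.rfl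

/-- `kzParab` is `ℚ`-semialgebraic. -/
theorem isSemialgebraic_kzParab : IsSemialgebraic ℚ kzParab := by
  convert isSemialgebraic_subgraph (4 * X 1 ^ 2) (1 + X 0 ^ 2) using 1
  ext z
  simp [kzParab]

/-- `kzParab` is the region under the graph of `p`. -/
theorem kzParab_eq : kzParab = {z | (0 < z 0 ∧ z 0 < 1) ∧ 0 ≤ z 1 ∧ z 1 ≤ parabF (z 0)} := by
  ext z
  simp only [mem_kzParab, mem_setOf_eq]
  refine and_congr_right fun _ => and_congr_right fun hy => ?_
  have hq : (0:ℝ) < 1 + z 0 ^ 2 := by positivity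
  rw [parabF_eq, le_div_iff₀ two_pos]
  constructor
  · intro h
    have h2 := Real.sqrt_le_sqrt (by nlinarith [h] : (z 1 * 2) ^ 2 ≤ 1 + z 0 ^ 2)
    rwa [Real.sqrt_sq (by positivity)] at h2
  · intro h
    have h2 := pow_le_pow_left₀ (by positivity) h 2
    rw [Real.sq_sqrt hq.le] at h2
    nlinarith [h2]

/-- `kzParab` lies in the unit square. -/
theorem kzParab_subset : kzParab ⊆ Icc 0 1 := subset_Icc_of_le_one fun z hz => by
  obtain ⟨hx, hy, h⟩ := hz
  refine ⟨hx, hy, ?_⟩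
  nlinarith [hx.1, hx.2]

/-- **`P = [{0<x<1, 0≤y, 4y²≤1+x²}, 1]`**, with `ℚ`-rational data. -/
def parab2 : IntegralRep 2 :=
  ratRep kzParab (fun _ => 1) 1 1 isSemialgebraic_kzParab (fun _ _ => by simp)
    (fun _ _ => by simp) (integrableOn_one_of_subset_Icc kzParab_subset)

/-- `P` has KZ's literal rational shape. -/
theorem isRational_parab2 : parab2.IsRational := isRational_ratRep

/-- **Move (Newton–Leibniz): `P ≡ P₁`.** -/
theorem parab2_sub_parab1 : of parab2 - of parab1 ∈ relations :=
  subgraph_sub_lineRep parab2 (fun x _ => parabF_nonneg x) kzParab_eq rfl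

/-! ## The rational representation `ρ = [(1, σ), (u²+1)²/(8u³)]` and the chart move -/

/-- `g(u) = (u²+1)²/(8u³)`. -/
def rhoF (u : ℝ) : ℝ := (u ^ 2 + 1) ^ 2 / (8 * u ^ 3)

/-- `g` is continuous on `(0, ∞)`. -/
theorem continuousOn_rhoF : ContinuousOn rhoF (Ioi 0) :=
  ((continuousOn_id.pow 2).add continuousOn_const).pow 2 |>.div
    (continuousOn_const.mul (continuousOn_id.pow 3)) fun u hu => by
      have hu0 : (0:ℝ) < u := hu
      positivity

/-- `g` is integrable on `(1, σ)`. -/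
theorem integrableOn_rhoF : IntegrableOn rhoF (Ioo 1 silver) :=
  ((continuousOn_rhoF.mono fun _ hu => one_pos.trans_le hu.1).integrableOn_compact
    isCompact_Icc).mono_set Ioo_subset_Icc_self

/-- `g` is `ℚ`-semialgebraic on `(1, σ)` (a rational function). -/
theorem isSemialgebraicFunOn_rhoF :
    IsSemialgebraicFunOn ℚ (line (Ioo 1 silver)) (fun x : Fin 1 → ℝ => rhoF (x 0)) := by
  have hS := isSemialgebraic_line_Ioo isAlgebraic_one isAlgebraic_silver
  refine (isSemialgebraicFunOn_aeval_div_aeval hS ((X 0 ^ 2 + 1) ^ 2) (8 * X 0 ^ 3)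
    fun x hx => ?_).congr fun x _ => ?_
  · have hx : 1 < x 0 := hx.1
    have h : aeval x (8 * X 0 ^ 3 : MvPolynomial (Fin 1) ℚ) = 8 * x 0 ^ 3 := by simp
    rw [h]
    positivity
  · simp [rhoF]

/-- **`ρ = [(1, 1+√2), (u²+1)² du/(8u³)]`.** -/
def rho : IntegralRep 1 :=
  lineRep (Ioo 1 silver) rhoF (isSemialgebraic_line_Ioo isAlgebraic_one isAlgebraic_silver)
    isSemialgebraicFunOn_rhoF integrableOn_rhoF

/-- **`ρ` has KZ's literal rational shape** (domain `{1 < u, u² - 2u - 1 < 0}`, integrand in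
`ℚ(u)`), although its endpoint `1+√2` is irrational. -/
theorem isRational_rho : rho.IsRational := by
  refine ⟨(X 0 ^ 2 + 1) ^ 2, 8 * X 0 ^ 3, fun x hx => ?_, fun x _ => ?_⟩
  · have hx : 1 < x 0 := hx.1
    have h : aeval x (8 * X 0 ^ 3 : MvPolynomial (Fin 1) ℚ) = 8 * x 0 ^ 3 := by simp
    rw [h]
    positivity
  · show rhoF (x 0) = _
    simp [rhoF]

/-- Pull-back of `p` along the silver chart: `p(φ(u))·|φ'(u)| = g(u)`. -/
theorem parabF_pullback {u : ℝ} (hu : 0 < u) :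
    rhoF u = parabF (sinhChart u) * |sinhChart' u| := by
  have hq : 1 + sinhChart u ^ 2 = ((u ^ 2 + 1) / (2 * u)) ^ 2 := by
    unfold sinhChart
    field_simp
    ring
  rw [abs_sinhChart' hu, parabF_eq, hq, Real.sqrt_sq (by positivity), rhoF]
  field_simp
  ring

/-- **Move (`x = (u²-1)/(2u)`): `ρ ≡ P₁`.** -/
theorem rho_sub_parab1 : of rho - of parab1 ∈ relations := by
  unfold rho parab1
  exact lineRep_subst sinhChart sinhChart' isSemialgebraicFunOn_sinhChart
    (fun t ht => (hasDerivAt_sinhChart (one_pos.trans ht.1)).hasDerivWithinAt) injOn_sinhChart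
    image_sinhChart (fun t ht => parabF_pullback (one_pos.trans ht.1))

/-- **`[P] = [ρ]`** in `Q`: two moves. -/
theorem mkQ_parab2 : mkQ (of parab2) = mkQ (of rho) := by
  rw [mkQ_eq_mkQ_iff, ← sub_sub_sub_cancel_right _ _ (of parab1)]
  exact relations.sub_mem parab2_sub_parab1 rho_sub_parab1

/-- **`P` lies in the cell span `V`** (through the rational one-variable representation `ρ`). -/
theorem mkQ_parab2_mem_cellSpan : mkQ (of parab2) ∈ cellSpan := by
  rw [mkQ_parab2]
  exact mkQ_of_mem_cellSpan rho le_rfl isRational_rho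

/-- **The Kontsevich–Zagier conjecture for `P`**, unconditionally, against every representation
with class in `V`. -/
theorem kz_parab2 {m : ℕ} (r' : IntegralRep m) (hr' : mkQ (of r') ∈ cellSpan)
    (hv : parab2.value = r'.value) : Equivalent parab2 r' :=
  kz_cellSpan mkQ_parab2_mem_cellSpan hr' hv

/-- In particular against every `ℚ`-rational representation of dimension `≤ 1`. -/
theorem kz_parab2_rational {m : ℕ} (hm : m ≤ 1) (r' : IntegralRep m) (hr' : r'.IsRational)
    (hv : parab2.value = r'.value) : Equivalent parab2 r' :=
  kz_parab2 r' (mkQ_of_mem_cellSpan r' hm hr') hv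

/-! ## The value of `ρ` by the fundamental theorem of calculus -/

/-- A primitive of `g`: `G(u) = u²/16 + (log u)/4 - 1/(16u²)`. -/
def rhoPrim (u : ℝ) : ℝ := u ^ 2 / 16 + Real.log u / 4 - (u ^ 2)⁻¹ / 16

/-- `G' = g` on `(0, ∞)`. -/
theorem hasDerivAt_rhoPrim {u : ℝ} (hu : 0 < u) : HasDerivAt rhoPrim (rhoF u) u := by
  have h1 : HasDerivAt (fun y : ℝ => y ^ 2 / 16) (2 * u / 16) u := by
    simpa using (hasDerivAt_pow 2 u).div_const 16
  have h2 : HasDerivAt (fun y : ℝ => Real.log y / 4) (u⁻¹ / 4) u :=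
    (Real.hasDerivAt_log hu.ne').div_const 4
  have h3 : HasDerivAt (fun y : ℝ => (y ^ 2)⁻¹ / 16) (-(2 * u) / (u ^ 2) ^ 2 / 16) u := by
    simpa using ((hasDerivAt_pow 2 u).inv (by positivity)).div_const 16
  have h := (h1.add h2).sub h3
  have he : 2 * u / 16 + u⁻¹ / 4 - -(2 * u) / (u ^ 2) ^ 2 / 16 = rhoF u := by
    rw [rhoF]
    field_simp
    ring
  rw [← he]
  exact h

/-- `σ⁻¹ = σ - 2`. -/
theorem silver_inv : silver⁻¹ = silver - 2 :=
  inv_eq_of_mul_eq_one_right (by nlinarith [silver_sq'])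

/-- `σ² - σ⁻² = 4(σ - 1)` (`= 4√2`). -/
theorem silver_sq_sub_inv_sq : silver ^ 2 - (silver ^ 2)⁻¹ = 4 * (silver - 1) := by
  rw [← inv_pow, silver_inv]
  nlinarith [silver_sq']

/-- **`∫_ρ = (σ - 1)/4 + (log σ)/4`** by the fundamental theorem of calculus. -/
theorem rho_value : rho.value = (silver - 1) / 4 + Real.log silver / 4 := by
  have hle := one_lt_silver.le
  rw [rho, value_lineRep, ← integral_Ioc_eq_integral_Ioo, ← intervalIntegral.integral_of_le hle,
    intervalIntegral.integral_eq_sub_of_hasDerivAt (f := rhoPrim)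
      (fun x hx => hasDerivAt_rhoPrim
        (one_pos.trans_le (by rw [uIcc_of_le hle] at hx; exact hx.1)))
      ((continuousOn_rhoF.mono fun u hu => ?_).intervalIntegrable_of_Icc hle)]
  · simp only [rhoPrim, one_pow, inv_one, Real.log_one, zero_div]
    linarith [silver_sq_sub_inv_sq]
  · exact mem_Ioi.mpr (one_pos.trans_le hu.1)

/-- `area(P)` in terms of `σ`. -/
theorem parab2_value' : parab2.value = (silver - 1) / 4 + Real.log silver / 4 := by
  rw [← rho_value]
  exact Equivalent.value_eq_holds (mkQ_eq_mkQ_iff.mp mkQ_parab2)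

/-- **`area(P) = ½∫₀¹ √(1+x²) dx = (√2 + log (1+√2))/4`**, read off from the moves and `∫_ρ`. -/
theorem parab2_value : parab2.value = (Real.sqrt 2 + Real.log (1 + Real.sqrt 2)) / 4 := by
  rw [parab2_value', silver]
  ring

/-! ## `4[P] = κ(√2) + ℓ(1+√2)` -/

/-- `√2 ∈ K₀`, written `σ - 1`. -/
def sqrtTwoK : K₀ := ⟨silver - 1, mem_K₀_iff.mpr (isAlgebraic_silver.sub isAlgebraic_one)⟩

/-- **`4[P] = κ(√2) + ℓ(1+√2)`** in `Q` (both sides lie in `V` and have the same period; Baker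
injectivity `eq_zero_of_mem_cellSpan`). -/
theorem four_mkQ_parab2 : 4 • mkQ (of parab2) = kappa sqrtTwoK + ell silver := by
  have hmem : 4 • mkQ (of parab2) - (kappa sqrtTwoK + ell silver) ∈ cellSpan :=
    sub_mem (nsmul_mem mkQ_parab2_mem_cellSpan 4)
      (add_mem (kappa_mem_cellSpan _) (ell_mem_cellSpan isAlgebraic_silver one_lt_silver))
  refine sub_eq_zero.mp (eq_zero_of_mem_cellSpan hmem ?_)
  rw [map_sub, map_add, map_nsmul, evalQ_mkQ, eval_of, parab2_value', evalQ_kappa,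
    evalQ_ell isAlgebraic_silver one_lt_silver.le, nsmul_eq_mul]
  simp only [sqrtTwoK, Nat.cast_ofNat]
  ring

/-- **Four copies of `P` ≡ the point cell `√2` plus `L(1; 1+√2)`**, as a relation of formal
representations. -/
theorem four_parab2_sub_mem_relations :
    4 • of parab2 - (of (constCell (silver - 1) (isAlgebraic_silver.sub isAlgebraic_one)) +
      of (logCell 1 silver isAlgebraic_one isAlgebraic_silver)) ∈ relations := by
  rw [← mkQ_eq_mkQ_iff, map_nsmul, map_add, four_mkQ_parab2, ← kappa_mk,
    ell_eq isAlgebraic_silver]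
  rfl

/-- **`4[P] - [Σ] = κ(√2)`**: the parabola region and the silver region differ, four to one, by
an algebraic area. -/
theorem four_mkQ_parab2_sub_mkQ_hyp2 : 4 • mkQ (of parab2) - mkQ (of hyp2) = kappa sqrtTwoK := by
  rw [four_mkQ_parab2, mkQ_hyp2, add_sub_cancel_right]

end SoloBlind

end Summit.KontsevichZagierPeriods.KontsevichZagierPeriods.Theorems
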